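import Summits.ResolutionOfSingularities.ResolutionOfSingularities.Theorems.HilbertSamuelEliminationSigmaMaxModificationsCorridor3WLadderIsoTailsTowerBaseChangeSatellite
import Summits.ResolutionOfSingularities.ResolutionOfSingularities.Theorems.HilbertSamuelEliminationSigmaMaxModificationsCorridor3WLadderIsoTailsFreeRationalFiniteCentres
import HarnessLib

/-!
# [OURS · L1 W4.2] K2-sep ROUTE A, brick (ε) MODULO RATIONALITY: **an isolated point tower over a maximal origin whose ground-field base change
# to `K` has RATIONAL steps cannot be everywhere free** — marked points of the base-changed tower exist over the marked points, and K1 à la carte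
# (`false_of_tower_of_forall_freeRational`) runs on `BlowupTower.baseChangeGR T pr₁` with all its inputs supplied by the (β)/(δ) bricks; the
# ONE remaining input, rationality of the base-changed steps (κ(s_n) = K for κ(x_n)/k separable, K separably closed), is kept as a hypothesis
# (crux `SigmaMaxModifications` stmt-ResolutionOfSingularities-18506 / conjunct stmt-…-19249; line `w_ladder_rows` v8.5, registered stub
# `stub_isoSepRecurrent`; res-L1-w42-plan-1 WORD 2026-08-27T16:25:47Z; design `L/res-L1-w42-stub-2/k2sep/K2SEP-DESIGN.md` §10 (ε))

Prover res-L1-w42-stub-2 (gen 5). Helper file `--supports stmt-ResolutionOfSingularities-19249 --as helper`; no definitions, no named fact. OURS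
(cell res-hironaka, slot W4.2); NOT statements of [Hironaka2017] nor of [CossartJannsenSaito2020]. AI-written; AI review is weaker than expert
review.

* **`BlowupTower.exists_markedPoints_bc`** — over marked points `x_{n+1} ↦ x_n` of `T` there are marked points `s_{n+1} ↦ s_n` of the base
  change with `ι_n s_n = x_n`.
* `BlowupTower.isPullback_bcι_phi` (canonical structure map), **`BlowupTower.isRationalStep_baseChangeGR_of_surjective`** (a `K`-rational
  marked point gives a rational step — reduces the remaining input to «closed points of `X ×_k K` over separable-residue points are `K`-rational»).
* **`false_of_isIsoPointTower_baseChangeGR_of_forall_free`** — (X₀,x₀) a maximal origin over `k` (`f : X₀ → Spec k` separated, locally of finite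
  type, quasi-compact, `char k = p`), `(T, pt)` an isolated point tower at level `3`, `K/k` separable algebraic, marked points `s` of the base change
  over `pt`, ALL base-changed steps rational, NO step of `T` satellite ⟹ `False`.

[OURS · L1 W4.2; AI-written] [cite: CossartJannsenSaito2020, Def. 6.38, p. 107] [cite: CossartPiltant2009, ch. 3 I.9]
-/

set_option linter.dupNamespace false

noncomputable section

open CategoryTheory CategoryTheory.Limits AlgebraicGeometry TopologicalSpace IsLocalRing
open Literature.AlgebraicGeometry.Resolution Literature.AlgebraicGeometry.CossartJannsenSaito2020
open Summit.ResolutionOfSingularities.ResolutionOfSingularities.Theorems.CampaignW42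
open Summit.ResolutionOfSingularities.ResolutionOfSingularities.Cruxes.SigmaMaxModifications.IdeasL1Idea2R4
open Summit.ResolutionOfSingularities.ResolutionOfSingularities.Cruxes.SigmaMaxModifications.IdeasL1C5
open Scheme.IdealSheafData

namespace Summit.ResolutionOfSingularities.ResolutionOfSingularities.Theorems.SigmaMaxModificationsCorridor3.IsoTailsHS

universe u

namespace BlowupTower

/-- **Marked points of a base-changed tower.** For `ι₀ : S₀ → X_0` with `ι₀` surjective onto `x_0`… precisely: given marked points `x_{n+1} ↦ x_n`
of `T` and a point `s_0 ∈ S₀` over `x_0`, there are points `s_n ∈ S_n` with `ι_n s_n = x_n` and `π′_n s_{n+1} = s_n` (points of a fibre product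
over a compatible pair exist, Mathlib `Scheme.Pullback.exists_preimage_pullback`). [folklore] -/
theorem exists_markedPoints_bc (T : BlowupTower.{u}) {S₀ : Scheme.{u}} (ι₀ : S₀ ⟶ T.X 0) (pt : ∀ n, T.X n)
    (hpt : ∀ n, (T.π n).base (pt (n + 1)) = pt n) (s₀ : S₀) (hs₀ : ι₀.base s₀ = pt 0) :
    ∃ s : ∀ n, ↥(T.bcX ι₀ n), (∀ n, (T.bcι ι₀ n).base (s n) = pt n) ∧ ∀ n, (T.bcπ ι₀ n).base (s (n + 1)) = s n := by
  -- dependent recursion on points over `pt n`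
  have step : ∀ n (t : {t : ↥(T.bcX ι₀ n) // (T.bcι ι₀ n).base t = pt n}),
      ∃ t' : {t' : ↥(T.bcX ι₀ (n + 1)) // (T.bcι ι₀ (n + 1)).base t' = pt (n + 1)}, (T.bcπ ι₀ n).base t'.1 = t.1 := by
    intro n t
    obtain ⟨z, hz1, hz2⟩ := Scheme.Pullback.exists_preimage_pullback (f := T.π n) (g := T.bcι ι₀ n) (pt (n + 1)) t.1
      (by rw [hpt n, t.2])
    exact ⟨⟨z, hz1⟩, hz2⟩
  let s : ∀ n, {t : ↥(T.bcX ι₀ n) // (T.bcι ι₀ n).base t = pt n} :=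
    fun n => Nat.rec (motive := fun n => {t : ↥(T.bcX ι₀ n) // (T.bcι ι₀ n).base t = pt n}) ⟨s₀, hs₀⟩
      (fun n t => Classical.choose (step n t)) n
  refine ⟨fun n => (s n).1, fun n => (s n).2, fun n => ?_⟩
  exact Classical.choose_spec (step n (s n))

/-- **`S_n = X_n ×_k K` with its CANONICAL structure map** `φ′_n ≫ pr₂ : S_n → S_0 = X_0 ×_k K → Spec K`: the square
`(ι_n, φ′_n ≫ pr₂; φ_n ≫ f, Spec K → Spec k)` is cartesian (pasting, as in `exists_isPullback_bcι`, with the base-changed tower's `phi`).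
[cite: GortzWedhorn2020, Prop. 13.91 (2)] -/
theorem isPullback_bcι_phi (T : BlowupTower.{u}) {k K : Type u} [Field k] [Field K] [Algebra k K] (f : T.X 0 ⟶ Spec (CommRingCat.of k))
    [Flat (pullback.fst f (Spec.map (CommRingCat.ofHom (algebraMap k K))))]
    [GeometricallyReduced (pullback.fst f (Spec.map (CommRingCat.ofHom (algebraMap k K))))]
    [IsLocallyNoetherian (pullback f (Spec.map (CommRingCat.ofHom (algebraMap k K))))] :
    ∀ n, IsPullback (T.bcι (pullback.fst f (Spec.map (CommRingCat.ofHom (algebraMap k K)))) n)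
      ((baseChangeGR T (pullback.fst f (Spec.map (CommRingCat.ofHom (algebraMap k K))))).phi n ≫
        pullback.snd f (Spec.map (CommRingCat.ofHom (algebraMap k K))))
      (T.phi n ≫ f) (Spec.map (CommRingCat.ofHom (algebraMap k K)))
  | 0 => by
      rw [T.phi_zero, Category.id_comp, Literature.AlgebraicGeometry.CossartJannsenSaito2020.BlowupTower.phi_zero, Category.id_comp]
      exact IsPullback.of_hasPullback f (Spec.map (CommRingCat.ofHom (algebraMap k K)))
  | n + 1 => by
      rw [T.phi_succ, Category.assoc, Literature.AlgebraicGeometry.CossartJannsenSaito2020.BlowupTower.phi_succ, Category.assoc]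
      exact (T.bc_isPullback _ n).paste_vert (isPullback_bcι_phi T f n)

/-- **RATIONAL STEPS FROM `K`-POINTS**: if the marked point `s_{n+1}` of the base-changed tower is a `K`-RATIONAL point of `S_{n+1} → Spec K`
(the residue field map of the structure morphism `φ′_{n+1} ≫ pr₂` at `s_{n+1}` is onto), then the step `s_n ← s_{n+1}` is rational
(`κ(s_n) → κ(s_{n+1})` is a factor of `K → κ(s_{n+1})`). The remaining input of the K2-sep assembly is therefore: «closed points of `X ×_k K` over
points with separable residue field are `K`-rational when `K` is separably closed». [folklore] -/
theorem isRationalStep_baseChangeGR_of_surjective (T : BlowupTower.{u}) {k K : Type u} [Field k] [Field K] [Algebra k K]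
    (f : T.X 0 ⟶ Spec (CommRingCat.of k))
    [Flat (pullback.fst f (Spec.map (CommRingCat.ofHom (algebraMap k K))))]
    [GeometricallyReduced (pullback.fst f (Spec.map (CommRingCat.ofHom (algebraMap k K))))]
    [IsLocallyNoetherian (pullback f (Spec.map (CommRingCat.ofHom (algebraMap k K))))]
    (s : ∀ n, ↥(T.bcX (pullback.fst f (Spec.map (CommRingCat.ofHom (algebraMap k K)))) n)) (n : ℕ)
    (hK : Function.Surjective (((baseChangeGR T (pullback.fst f (Spec.map (CommRingCat.ofHom (algebraMap k K))))).phi (n + 1) ≫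
        pullback.snd f (Spec.map (CommRingCat.ofHom (algebraMap k K)))).residueFieldMap (s (n + 1))).hom) :
    IsRationalStep (baseChangeGR T (pullback.fst f (Spec.map (CommRingCat.ofHom (algebraMap k K))))) s n := by
  unfold IsRationalStep
  rw [Literature.AlgebraicGeometry.CossartJannsenSaito2020.BlowupTower.phi_succ, Category.assoc, Scheme.residueFieldMap_comp] at hK
  erw [CommRingCat.hom_comp, RingHom.coe_comp] at hK
  exact Function.Surjective.of_comp hK

end BlowupTower

set_option maxHeartbeats 800000 in
-- the base-changed tower term is large
/-- **K2-sep, ASSEMBLY MODULO RATIONALITY.** Let `(X_0, x_0)` be a maximal origin at level `3`, value `ν`, characteristic `p`, presented by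
`f : X_0 → Spec k` (separated, locally of finite type, quasi-compact, `char k = p`), `(T, pt)` an isolated point tower over it, `K/k` separable
algebraic, and `s` marked points of the base-changed tower `S_• = X_• ×_k K` over `pt`. If every base-changed step `s_n ← s_{n+1}` is RATIONAL and no
step of `T` is a satellite step, we reach a contradiction: `(S_•, s)` satisfies every hypothesis of K1 à la carte
(`false_of_tower_of_forall_freeRational`) — maximal origins (`isMaximalOrigin_bcX`), closed marked points, `H ≡ ν` (`hsFun_bcX_eq`), centres
`ι_n⁻¹{x_n}` with `𝓘_{x_n} = 𝔪` at `s_n` (`stalkIdeal_vanishingIdeal_eq_maximalIdeal_of_finite`), isolation at stage `1` (`isIsolatedInHSMaxLocus_bcX`),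
no satellites (`isSatelliteStep_baseChangeGR_iff`). [OURS · L1 W4.2; AI-written] [cite: CossartJannsenSaito2020, Def. 6.38, p. 107] -/
theorem false_of_isIsoPointTower_baseChangeGR_of_forall_free {p : ℕ} {ν : ℕ → ℕ} {k K : Type u} [Field k] [CharP k p] [Field K]
    [Algebra k K] [Algebra.IsSeparable k K] {T : BlowupTower.{u}} {pt : ∀ n, T.X n} (f : T.X 0 ⟶ Spec (CommRingCat.of k))
    [IsSeparated f] [LocallyOfFiniteType f] [QuasiCompact f]
    [Flat (pullback.fst f (Spec.map (CommRingCat.ofHom (algebraMap k K))))]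
    [GeometricallyReduced (pullback.fst f (Spec.map (CommRingCat.ofHom (algebraMap k K))))]
    [IsLocallyNoetherian (pullback f (Spec.map (CommRingCat.ofHom (algebraMap k K))))]
    (hO : IsMaximalOrigin p 3 ν (T.X 0) (pt 0)) (hT : IsIsoPointTower 3 ν T pt)
    (s : ∀ n, ↥(T.bcX (pullback.fst f (Spec.map (CommRingCat.ofHom (algebraMap k K)))) n))
    (hι : ∀ n, (T.bcι (pullback.fst f (Spec.map (CommRingCat.ofHom (algebraMap k K)))) n).base (s n) = pt n)
    (hsπ : ∀ n, (T.bcπ (pullback.fst f (Spec.map (CommRingCat.ofHom (algebraMap k K)))) n).base (s (n + 1)) = s n)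
    (hratK : ∀ n, IsRationalStep (BlowupTower.baseChangeGR T (pullback.fst f (Spec.map (CommRingCat.ofHom (algebraMap k K))))) s n)
    (hnsat : ∀ n, ¬ IsSatelliteStep T pt n) : False := by
  have hpteq : (fun m => (T.bcι (pullback.fst f (Spec.map (CommRingCat.ofHom (algebraMap k K)))) m).base (s m)) = pt := funext hι
  have hclpt : ∀ n, IsClosed ({pt n} : Set (T.X n)) := hT.2.2.1
  have hcls : ∀ n, IsClosed ({s n} : Set ↥(T.bcX (pullback.fst f (Spec.map (CommRingCat.ofHom (algebraMap k K)))) n)) := fun n =>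
    BlowupTower.isClosed_singleton_bcX (T := T) (f := f) n (hclpt n) (hι n)
  refine false_of_tower_of_forall_freeRational (T := BlowupTower.baseChangeGR T (pullback.fst f (Spec.map (CommRingCat.ofHom (algebraMap k K))))) (pt := s) (p := p) (ν := ν)
    ?_ ?_ hsπ hcls ?_ ?_ ?_ hratK ?_
  · -- maximal origin at stage 0
    exact BlowupTower.isMaximalOrigin_bcX (T := T) (f := f) 3 0 hO (hι 0)
  · -- maximal origin at stage 1
    exact BlowupTower.isMaximalOrigin_bcX (T := T) (f := f) 3 1 (hT.isMaximalOrigin hO 1) (hι 1)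
  · -- `H ≡ ν`
    intro n
    show Scheme.hsFun (T.bcX (pullback.fst f (Spec.map (CommRingCat.ofHom (algebraMap k K)))) n) 3 (s n) = ν
    rw [BlowupTower.hsFun_bcX_eq (T := T) (f := f) 3 n (s n), hι n]
    exact hT.2.2.2.1 n
  · -- the centre `ι_n⁻¹{x_n}` has stalk ideal `𝔪` at `s_n`
    intro n
    show stalkIdeal (vanishingIdeal ⟨(T.bcι (pullback.fst f (Spec.map (CommRingCat.ofHom (algebraMap k K)))) n).base ⁻¹' T.C n, _⟩) (s n) = maximalIdeal _
    have hC : (T.bcι (pullback.fst f (Spec.map (CommRingCat.ofHom (algebraMap k K)))) n).base ⁻¹' T.C n = (T.bcι (pullback.fst f (Spec.map (CommRingCat.ofHom (algebraMap k K)))) n).base ⁻¹' {pt n} := by rw [hT.1 n]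
    have hfin : ((T.bcι (pullback.fst f (Spec.map (CommRingCat.ofHom (algebraMap k K)))) n).base ⁻¹' {pt n}).Finite := BlowupTower.finite_preimage_bcι (T := T) (f := f) n (hclpt n)
    have hcl' : ∀ y ∈ (T.bcι (pullback.fst f (Spec.map (CommRingCat.ofHom (algebraMap k K)))) n).base ⁻¹' {pt n}, IsClosed ({y} : Set ↥(T.bcX (pullback.fst f (Spec.map (CommRingCat.ofHom (algebraMap k K)))) n)) := fun y hy =>
      BlowupTower.isClosed_singleton_bcX (T := T) (f := f) n (hclpt n) hy
    have hmem : s n ∈ (T.bcι (pullback.fst f (Spec.map (CommRingCat.ofHom (algebraMap k K)))) n).base ⁻¹' {pt n} := hι n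
    have key := stalkIdeal_vanishingIdeal_eq_maximalIdeal_of_finite
      (((hclpt n).preimage (T.bcι (pullback.fst f (Spec.map (CommRingCat.ofHom (algebraMap k K)))) n).continuous)) hfin hcl' hmem
    convert key using 3
    exact Closeds.ext hC
  · -- isolation at stage 1
    exact BlowupTower.isIsolatedInHSMaxLocus_bcX (T := T) (f := f) 3 1 (hT.2.2.2.2.1 1) (hclpt 1) (hι 1)
  · -- no satellites upstairs
    intro n hsat
    have h := (BlowupTower.isSatelliteStep_baseChangeGR_iff (T := T) (f := f) n s (by rw [hι (n + 2)]; exact hclpt (n + 2))).mp hsat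
    rw [hpteq] at h
    exact hnsat n h

end Summit.ResolutionOfSingularities.ResolutionOfSingularities.Theorems.SigmaMaxModificationsCorridor3.IsoTailsHS

end
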